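/-
K-task «TOWER», PART E helpers (cell rh-split, lead RULINGS #354 (b) / #359 (b); referee rh-split-ref-2 g7
23:48:37Z).  Elementary lemmas for the thin blind model `ScrewLatticeTowerThin`: tuning inside a band, depth
bookkeeping, the weight-adapted alias window, the counting algebra.  Nothing here bears on the truth of RH.
-/
import Summits.RiemannHypothesis.RiemannHypothesis.Theorems.Splittings.ScrewLatticeTowerA
import Mathlib.Analysis.SpecialFunctions.Pow.Real
import Mathlib.Analysis.Complex.Basic
import HarnessLib

/-!
# The rigid polygon TOWER, part E helpers: tuning band, alias window, counting algebra

ζ-free, RH-free elementary real analysis used by `ScrewLatticeTowerThin.exists_tower_thin_blind_model`: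

* `exists_tuning_band` — B16's explicit tuning solution (`ScrewLatticeWolffModel.exists_tuning_bound`) with a
  TWO-SIDED bound `c γ_j²/3 ≤ m_j ≤ 3 c γ_j²` when `2σ ≤ γ_j` and `γ₁, γ₂` are within a factor `2`;
* `depth_hyps` — `c ≤ 1/(β+3)` gives `e^{-1/c} ≤ 1/18` and `2^β e^{-1/c} ≤ 1/4`;
* `alias_window` — for the weight-adapted alias `N = N₀ + ⌈1/s⌉` (`s = √α`): the ordinate window
  `[(2πN - π)/h, (2πN + π)/h]` starts above `2π/(h s)`, has ratio `≤ 2`, and `s · (2πN + π)/h ≤ U(N₀, S, h)`;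
* `sq_window_lower` — hence `4π²/h² ≤ s² γ²` on the window;
* `nat_le_floor_rpow`, `count_algebra` — the bookkeeping `α ℓ^{β+1} ≤ E`, `a₀ ≤ α T²` ⇒ `ℓ ≤ ⌊(E T²/a₀)^{1/(β+1)}⌋`
  and `#s ≤ K + (L+1)²`, `L ≤ (D T²)^{1/(β+1)}`, `4/e ≤ β`, `T ≥ 1` ⇒ `#s ≤ (K + (D^{1/(β+1)} + 1)²) T^e`.

Nothing here bears on the truth of RH.
-/

noncomputable section

set_option linter.dupNamespace false

open Complex
open scoped ComplexConjugate Real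

namespace Summit.RiemannHypothesis.RiemannHypothesis.Theorems.Splittings.ScrewLatticeTower

/-! ## 13. Tuning inside a band -/

/-- `ScrewLatticeWolffModel.exists_tuning_bound` with a TWO-SIDED bound: for `2σ ≤ γ_j` and `γ₁, γ₂` within a
factor `2` of each other, the explicit tuning solution satisfies `c γ_j²/3 ≤ m_j ≤ 3 c γ_j²`. -/
theorem exists_tuning_band {σ γ₁ γ₂ c : ℝ} (hσ : 0 < σ) (h₁ : 2 * σ ≤ γ₁) (h₂ : 2 * σ ≤ γ₂)
    (h₁₂ : γ₂ ≤ 2 * γ₁) (h₂₁ : γ₁ ≤ 2 * γ₂) (hc : 0 < c) :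
    ∃ m₁ m₂ : ℝ, 0 < m₁ ∧ 0 < m₂ ∧
      (m₁ : ℂ) / ((σ : ℂ) + γ₁ * I) ^ 2 + (m₂ : ℂ) / (conj ((σ : ℂ) + γ₂ * I)) ^ 2 = -(c : ℂ) ∧
      m₁ / γ₁ ^ 2 ≤ 3 * c ∧ m₂ / γ₂ ^ 2 ≤ 3 * c ∧ c * γ₁ ^ 2 ≤ 3 * m₁ ∧ c * γ₂ ^ 2 ≤ 3 * m₂ := by
  have hγ₁ : σ < γ₁ := by linarith
  have hγ₂ : σ < γ₂ := by linarith
  have hγ₁0 : 0 < γ₁ := hσ.trans hγ₁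
  have hγ₂0 : 0 < γ₂ := hσ.trans hγ₂
  set n₁ : ℝ := σ ^ 2 + γ₁ ^ 2 with hn₁
  set n₂ : ℝ := σ ^ 2 + γ₂ ^ 2 with hn₂
  have hn₁0 : 0 < n₁ := by positivity
  have hn₂0 : 0 < n₂ := by positivity
  set D : ℝ := γ₂ * (γ₁ ^ 2 - σ ^ 2) + γ₁ * (γ₂ ^ 2 - σ ^ 2) with hD
  have hg₁ : 0 < γ₁ ^ 2 - σ ^ 2 := by nlinarith
  have hg₂ : 0 < γ₂ ^ 2 - σ ^ 2 := by nlinarith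
  have hD0 : 0 < D := by positivity
  refine ⟨c * γ₂ * n₁ ^ 2 / D, c * γ₁ * n₂ ^ 2 / D, by positivity, by positivity, ?_, ?_, ?_, ?_, ?_⟩
  · -- the tuning identity (same computation as `ScrewLatticeWolff.exists_tuning`)
    have hκ₁ : ((σ : ℂ) + γ₁ * I) ^ 2 ≠ 0 := by
      apply pow_ne_zero
      intro h0
      have := congrArg Complex.im h0
      simp at this
      linarith
    have hκ₂ : (conj ((σ : ℂ) + γ₂ * I)) ^ 2 ≠ 0 := by
      apply pow_ne_zero
      intro h0
      have := congrArg Complex.im h0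
      simp at this
      linarith
    rw [div_add_div _ _ hκ₁ hκ₂, div_eq_iff (mul_ne_zero hκ₁ hκ₂)]
    have hDne : D ≠ 0 := hD0.ne'
    apply Complex.ext
    · simp only [Complex.add_re, Complex.mul_re, Complex.mul_im, Complex.neg_re, Complex.neg_im,
        Complex.ofReal_re, Complex.ofReal_im]
      simp only [sq, Complex.mul_re, Complex.mul_im, Complex.add_re, Complex.add_im, Complex.ofReal_re,
        Complex.ofReal_im, Complex.I_re, Complex.I_im, Complex.conj_re, Complex.conj_im]
      field_simp
      rw [hD, hn₁, hn₂]
      ring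
    · simp only [Complex.add_im, Complex.mul_re, Complex.mul_im, Complex.neg_re, Complex.neg_im,
        Complex.ofReal_re, Complex.ofReal_im]
      simp only [sq, Complex.mul_re, Complex.mul_im, Complex.add_re, Complex.add_im, Complex.ofReal_re,
        Complex.ofReal_im, Complex.I_re, Complex.I_im, Complex.conj_re, Complex.conj_im]
      field_simp
      rw [hD, hn₁, hn₂]
      ring
  · -- upper bound for m₁: D ≥ γ₂ (γ₁² - σ²) ≥ (3/4) γ₂ γ₁² and n₁ ≤ (3/2) γ₁²
    have hD1 : γ₂ * (γ₁ ^ 2 - σ ^ 2) ≤ D := by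
      rw [hD]; nlinarith [mul_pos hγ₁0 hg₂]
    have hs : σ ^ 2 ≤ γ₁ ^ 2 / 4 := by nlinarith
    have hn : n₁ ≤ 3 / 2 * γ₁ ^ 2 := by rw [hn₁]; linarith
    have hkey : c * γ₂ * n₁ ^ 2 ≤ 3 * c * γ₁ ^ 2 * D := by
      have e1 : n₁ ^ 2 ≤ (3 / 2 * γ₁ ^ 2) ^ 2 := pow_le_pow_left₀ hn₁0.le hn 2
      have e2 : 3 / 4 * γ₁ ^ 2 ≤ γ₁ ^ 2 - σ ^ 2 := by linarith
      have e3 : γ₂ * (3 / 4 * γ₁ ^ 2) ≤ D := (mul_le_mul_of_nonneg_left e2 hγ₂0.le).trans hD1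
      calc c * γ₂ * n₁ ^ 2 ≤ c * γ₂ * (3 / 2 * γ₁ ^ 2) ^ 2 := by
            exact mul_le_mul_of_nonneg_left e1 (by positivity)
        _ = 3 * c * γ₁ ^ 2 * (γ₂ * (3 / 4 * γ₁ ^ 2)) := by ring
        _ ≤ 3 * c * γ₁ ^ 2 * D := by
            exact mul_le_mul_of_nonneg_left e3 (by positivity)
    rw [div_le_iff₀ (by positivity), div_le_iff₀ hD0]
    linarith
  · have hD2 : γ₁ * (γ₂ ^ 2 - σ ^ 2) ≤ D := by
      rw [hD]; nlinarith [mul_pos hγ₂0 hg₁]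
    have hs : σ ^ 2 ≤ γ₂ ^ 2 / 4 := by nlinarith
    have hn : n₂ ≤ 3 / 2 * γ₂ ^ 2 := by rw [hn₂]; linarith
    have hkey : c * γ₁ * n₂ ^ 2 ≤ 3 * c * γ₂ ^ 2 * D := by
      have e1 : n₂ ^ 2 ≤ (3 / 2 * γ₂ ^ 2) ^ 2 := pow_le_pow_left₀ hn₂0.le hn 2
      have e2 : 3 / 4 * γ₂ ^ 2 ≤ γ₂ ^ 2 - σ ^ 2 := by linarith
      have e3 : γ₁ * (3 / 4 * γ₂ ^ 2) ≤ D := (mul_le_mul_of_nonneg_left e2 hγ₁0.le).trans hD2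
      calc c * γ₁ * n₂ ^ 2 ≤ c * γ₁ * (3 / 2 * γ₂ ^ 2) ^ 2 := by
            exact mul_le_mul_of_nonneg_left e1 (by positivity)
        _ = 3 * c * γ₂ ^ 2 * (γ₁ * (3 / 4 * γ₂ ^ 2)) := by ring
        _ ≤ 3 * c * γ₂ ^ 2 * D := by
            exact mul_le_mul_of_nonneg_left e3 (by positivity)
    rw [div_le_iff₀ (by positivity), div_le_iff₀ hD0]
    linarith
  · -- lower bound for m₁: D ≤ γ₁ γ₂ (γ₁ + γ₂) ≤ 3 γ₁² γ₂ and n₁² ≥ γ₁⁴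
    have hDle : D ≤ 3 * γ₁ ^ 2 * γ₂ := by
      rw [hD]
      have e1 : γ₁ * γ₂ ^ 2 ≤ 2 * γ₁ ^ 2 * γ₂ := by nlinarith [mul_pos hγ₁0 hγ₂0]
      nlinarith [mul_pos hγ₁0 hγ₂0, sq_nonneg σ]
    have hn4 : γ₁ ^ 4 ≤ n₁ ^ 2 := by
      have : γ₁ ^ 2 ≤ n₁ := by rw [hn₁]; nlinarith
      calc γ₁ ^ 4 = (γ₁ ^ 2) ^ 2 := by ring
        _ ≤ n₁ ^ 2 := pow_le_pow_left₀ (by positivity) this 2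
    rw [show 3 * (c * γ₂ * n₁ ^ 2 / D) = 3 * c * γ₂ * n₁ ^ 2 / D by ring, le_div_iff₀ hD0]
    calc c * γ₁ ^ 2 * D ≤ c * γ₁ ^ 2 * (3 * γ₁ ^ 2 * γ₂) := by gcongr
      _ = 3 * c * γ₂ * γ₁ ^ 4 := by ring
      _ ≤ 3 * c * γ₂ * n₁ ^ 2 := by gcongr
  · have hDle : D ≤ 3 * γ₂ ^ 2 * γ₁ := by
      rw [hD]
      have e1 : γ₂ * γ₁ ^ 2 ≤ 2 * γ₂ ^ 2 * γ₁ := by nlinarith [mul_pos hγ₁0 hγ₂0]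
      nlinarith [mul_pos hγ₁0 hγ₂0, sq_nonneg σ]
    have hn4 : γ₂ ^ 4 ≤ n₂ ^ 2 := by
      have : γ₂ ^ 2 ≤ n₂ := by rw [hn₂]; nlinarith
      calc γ₂ ^ 4 = (γ₂ ^ 2) ^ 2 := by ring
        _ ≤ n₂ ^ 2 := pow_le_pow_left₀ (by positivity) this 2
    rw [show 3 * (c * γ₁ * n₂ ^ 2 / D) = 3 * c * γ₁ * n₂ ^ 2 / D by ring, le_div_iff₀ hD0]
    calc c * γ₂ ^ 2 * D ≤ c * γ₂ ^ 2 * (3 * γ₂ ^ 2 * γ₁) := by gcongr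
      _ = 3 * c * γ₁ * γ₂ ^ 4 := by ring
      _ ≤ 3 * c * γ₁ * n₂ ^ 2 := by gcongr

/-! ## 14. Depth bookkeeping -/

/-- Depth `c ≤ 1/(β + 3)` gives both depth hypotheses of part E: `e^{-1/c} ≤ 1/18` (part A's
`exp_neg_inv_le`) and `2^β e^{-1/c} ≤ 1/4` (from `e^{-1/c} ≤ e^{-(β+3)} ≤ 2^{-(β+3)}`). -/
theorem depth_hyps {c : ℝ} (hc : 0 < c) (β : ℕ) (hcβ : c ≤ 1 / ((β : ℝ) + 3)) :
    Real.exp (-(1 / c)) ≤ 1 / 18 ∧ (2 : ℝ) ^ β * Real.exp (-(1 / c)) ≤ 1 / 4 := by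
  have hβ0 : (0 : ℝ) ≤ β := Nat.cast_nonneg β
  have hc3 : c ≤ 1 / 3 := hcβ.trans (by
    rw [div_le_div_iff₀ (by positivity) (by norm_num : (0:ℝ) < 3)]; linarith)
  refine ⟨exp_neg_inv_le hc hc3, ?_⟩
  -- `1/c ≥ β + 3`, so `e^{-1/c} ≤ (e^{-1})^{β+3} ≤ (1/2)^{β+3}`
  have h1 : (β : ℝ) + 3 ≤ 1 / c := by
    rw [le_div_iff₀ hc]
    have := mul_le_mul_of_nonneg_left hcβ (by positivity : (0 : ℝ) ≤ (β : ℝ) + 3)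
    rw [mul_one_div_cancel (by positivity)] at this
    linarith
  have h2 : Real.exp (-(1 / c)) ≤ Real.exp (-1) ^ (β + 3) := by
    rw [← Real.exp_nat_mul]
    apply Real.exp_le_exp.mpr
    push_cast
    nlinarith
  have h3 : Real.exp (-1 : ℝ) ≤ 1 / 2 := by
    have h := Real.add_one_le_exp (1 : ℝ)
    rw [Real.exp_neg, inv_eq_one_div, div_le_div_iff₀ (Real.exp_pos 1) two_pos]
    linarith
  have h4 : Real.exp (-1) ^ (β + 3) ≤ (1 / 2 : ℝ) ^ (β + 3) :=
    pow_le_pow_left₀ (Real.exp_pos _).le h3 _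
  calc (2 : ℝ) ^ β * Real.exp (-(1 / c)) ≤ (2 : ℝ) ^ β * (1 / 2 : ℝ) ^ (β + 3) := by
        exact mul_le_mul_of_nonneg_left (h2.trans h4) (by positivity)
    _ = 1 / 8 := by rw [pow_add, one_div_pow, ← mul_assoc, mul_one_div_cancel (by positivity)]; norm_num
    _ ≤ 1 / 4 := by norm_num

/-! ## 15. The weight-adapted alias window -/

/-- **Alias window.**  For `h > 0`, `s > 0` (read `s = √α`), `N₀ ≥ 2` and an alias index `N` with
`N₀ + 1/s ≤ N ≤ N₀ + 1/s + 1` (e.g. `N = N₀ + ⌈1/s⌉₊`): the ordinate window `[(2πN - π)/h, (2πN + π)/h]` lies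
above `2π/(h s)`, its two ends are within a factor `2`, and `s · (2πN + π)/h ≤ (2π + (2N₀ + 3)π s)/h`. -/
theorem alias_window {h s N₀ : ℝ} {N : ℕ} (hh : 0 < h) (hs : 0 < s) (hN₀ : 2 ≤ N₀)
    (hN : N₀ + 1 / s ≤ N) (hN' : (N : ℝ) ≤ N₀ + 1 / s + 1) :
    2 * π / (h * s) ≤ (2 * π * N - π) / h ∧
    (2 * π * N + π) / h ≤ 2 * ((2 * π * N - π) / h) ∧
    s * ((2 * π * N + π) / h) ≤ (2 * π + (2 * N₀ + 3) * π * s) / h := by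
  have hπ := Real.pi_pos
  have h1s : 0 < 1 / s := by positivity
  have hN2 : (2 : ℝ) ≤ N := by linarith
  refine ⟨?_, ?_, ?_⟩
  · -- `2π h ≤ (2πN - π) h s`: `N ≥ 1 + 1/s` gives `2πN - π ≥ 2π/s`
    rw [div_le_div_iff₀ (by positivity) hh]
    have h1 : 2 * π * (1 / s) ≤ 2 * π * N - π := by nlinarith
    have h2 : 2 * π * (1 / s) * (h * s) = 2 * π * h := by field_simp
    calc 2 * π * h = 2 * π * (1 / s) * (h * s) := h2.symm
      _ ≤ (2 * π * N - π) * (h * s) := mul_le_mul_of_nonneg_right h1 (by positivity)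
  · rw [← mul_div_assoc]
    apply div_le_div_of_nonneg_right _ hh.le
    nlinarith
  · rw [mul_div_assoc', div_le_div_iff_of_pos_right hh]
    have h1 : s * (2 * π * N + π) ≤ s * (2 * π * (N₀ + 1 / s + 1) + π) := by
      apply mul_le_mul_of_nonneg_left _ hs.le; nlinarith
    have h2 : s * (2 * π * (N₀ + 1 / s + 1) + π) = 2 * π + (2 * N₀ + 3) * π * s := by
      field_simp; ring
    linarith

/-- On the alias window the weight controls the ordinate from below: `2π/(h s) ≤ γ ⇒ 4π²/h² ≤ s² γ²`. -/
theorem sq_window_lower {h s γ : ℝ} (hh : 0 < h) (hs : 0 < s) (hγ : 2 * π / (h * s) ≤ γ) :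
    4 * π ^ 2 / h ^ 2 ≤ s ^ 2 * γ ^ 2 := by
  have hπ := Real.pi_pos
  have h0 : 0 ≤ 2 * π / (h * s) := by positivity
  have h2 := pow_le_pow_left₀ h0 hγ 2
  have h3 : (2 * π / (h * s)) ^ 2 * (h ^ 2 * s ^ 2) = 4 * π ^ 2 := by
    field_simp; ring
  rw [div_le_iff₀ (by positivity)]
  calc 4 * π ^ 2 = (2 * π / (h * s)) ^ 2 * (h ^ 2 * s ^ 2) := h3.symm
    _ ≤ γ ^ 2 * (h ^ 2 * s ^ 2) := mul_le_mul_of_nonneg_right h2 (by positivity)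
    _ = s ^ 2 * γ ^ 2 * h ^ 2 := by ring

/-! ## 16. The counting algebra -/

/-- From `α ℓ^{β+1} ≤ E` and `a₀ ≤ α T²` (`a₀ > 0`): `ℓ ≤ ⌊(E/a₀ · T²)^{1/(β+1)}⌋`. -/
theorem nat_le_floor_rpow {α a₀ E T : ℝ} {ℓ β : ℕ} (ha₀ : 0 < a₀) (hE : α * (ℓ : ℝ) ^ (β + 1) ≤ E)
    (hαT : a₀ ≤ α * T ^ 2) :
    ℓ ≤ ⌊(E / a₀ * T ^ 2) ^ ((β + 1 : ℕ) : ℝ)⁻¹⌋₊ := by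
  have hℓ0 : (0 : ℝ) ≤ (ℓ : ℝ) := Nat.cast_nonneg ℓ
  have hαT0 : 0 < α * T ^ 2 := lt_of_lt_of_le ha₀ hαT
  have hX : (ℓ : ℝ) ^ (β + 1) ≤ E / a₀ * T ^ 2 := by
    -- `ℓ^{β+1} a₀ ≤ ℓ^{β+1} α T² ≤ E T²`
    have h1 : (ℓ : ℝ) ^ (β + 1) * a₀ ≤ E * T ^ 2 := by
      calc (ℓ : ℝ) ^ (β + 1) * a₀ ≤ (ℓ : ℝ) ^ (β + 1) * (α * T ^ 2) :=
            mul_le_mul_of_nonneg_left hαT (by positivity)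
        _ = α * (ℓ : ℝ) ^ (β + 1) * T ^ 2 := by ring
        _ ≤ E * T ^ 2 := mul_le_mul_of_nonneg_right hE (by positivity)
    rw [div_mul_eq_mul_div, le_div_iff₀ ha₀]
    exact h1
  have hX0 : 0 ≤ E / a₀ * T ^ 2 := le_trans (by positivity) hX
  have h1 := Real.rpow_le_rpow (by positivity) hX (by positivity : (0 : ℝ) ≤ ((β + 1 : ℕ) : ℝ)⁻¹)
  rw [Real.pow_rpow_inv_natCast hℓ0 (by omega)] at h1
  exact Nat.le_floor h1

/-- The counting algebra: `#s ≤ K + (L+1)²`, `L ≤ (D T²)^{1/(β+1)}`, `4/e ≤ β`, `T ≥ 1` give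
`#s ≤ (K + (D^{1/(β+1)} + 1)²) · T^e`. -/
theorem count_algebra {K L n β : ℕ} {D e T : ℝ} (hD : 0 ≤ D) (hT : 1 ≤ T) (he : 0 < e)
    (hβe : 4 / e ≤ β) (hL : (L : ℝ) ≤ (D * T ^ 2) ^ ((β + 1 : ℕ) : ℝ)⁻¹) (hn : n ≤ K + (L + 1) ^ 2) :
    (n : ℝ) ≤ (K + (D ^ ((β + 1 : ℕ) : ℝ)⁻¹ + 1) ^ 2) * T ^ e := by
  set p : ℝ := ((β + 1 : ℕ) : ℝ)⁻¹ with hp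
  have hp0 : 0 ≤ p := by positivity
  have hT0 : 0 ≤ T := by linarith
  have h4p : 4 * p ≤ e := by
    rw [hp, ← div_eq_mul_inv, div_le_iff₀ (by positivity)]
    push_cast
    have : 4 ≤ e * β := by rwa [div_le_iff₀' he] at hβe
    nlinarith
  set c₁ : ℝ := D ^ p with hc₁
  have hc₁0 : 0 ≤ c₁ := by positivity
  have hXp : (D * T ^ 2) ^ p = c₁ * T ^ (2 * p) := by
    rw [hc₁, Real.mul_rpow hD (by positivity), Real.rpow_mul hT0, Real.rpow_two]
  have hT4p : 1 ≤ T ^ (4 * p) := Real.one_le_rpow hT (by positivity)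
  have hTe : T ^ (4 * p) ≤ T ^ e := Real.rpow_le_rpow_of_exponent_le hT h4p
  have hsq : (T ^ (2 * p)) ^ 2 = T ^ (4 * p) := by
    rw [← Real.rpow_two, ← Real.rpow_mul hT0]; ring_nf
  have hT2p : 1 ≤ T ^ (2 * p) := Real.one_le_rpow hT (by positivity)
  have hn' : (n : ℝ) ≤ K + ((L : ℝ) + 1) ^ 2 := by exact_mod_cast hn
  rw [hXp] at hL
  have h1 : (L : ℝ) + 1 ≤ (c₁ + 1) * T ^ (2 * p) := by nlinarith
  have h2 : ((L : ℝ) + 1) ^ 2 ≤ ((c₁ + 1) * T ^ (2 * p)) ^ 2 := pow_le_pow_left₀ (by positivity) h1 2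
  rw [mul_pow, hsq] at h2
  have hK0 : (0 : ℝ) ≤ K := Nat.cast_nonneg K
  have h3 : (K : ℝ) ≤ K * T ^ (4 * p) := le_mul_of_one_le_right hK0 hT4p
  calc (n : ℝ) ≤ K + ((L : ℝ) + 1) ^ 2 := hn'
    _ ≤ K * T ^ (4 * p) + (c₁ + 1) ^ 2 * T ^ (4 * p) := add_le_add h3 h2
    _ = (K + (c₁ + 1) ^ 2) * T ^ (4 * p) := by ring
    _ ≤ (K + (c₁ + 1) ^ 2) * T ^ e := mul_le_mul_of_nonneg_left hTe (by positivity)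

end Summit.RiemannHypothesis.RiemannHypothesis.Theorems.Splittings.ScrewLatticeTower

end
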